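import Literature.Topology.PlanarFoliations.ProngStarEnds
import Literature.Topology.PlanarFoliations.MonotoneFamily
import HarnessLib

/-!
# The horizontals of a prong star near a prong point, read in one flow box

Topic: Topology / PlanarFoliations, sequel to `ProngStarEnds.lean` (the horizontal paths
`horiz j h β` of the sectors of a prong star), `MonotoneFamily.lean`. Around a point
`x₀ = horiz j 0 b₀` of the prong of the sector `j` (`0 < b₀ < ρ`), **the horizontals at the
heights `h` near `0` are read in one flow box `e` of the atlas** (the box of the foliated
structure of the star at `x₀`): they are jointly continuous in `(β, h)` (`continuousOn_horiz₂`),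
each one lies in one plaque of `e` (`height_horiz_eq`), and — the point of this file —
**the leaf coordinate of `e` is uniformly strictly monotone in `β` along all of them, with one
monotonicity type** (`exists_box_uniform_type`), by the one-type lemma for continuous families of
injective functions. This is the local input for the orientation of the prongs (in/out
alternation) and for reading the direction of leaves passing through the hyperbolic sectors.

All statements are [folklore].
-/

noncomputable section

open Set Filter Function Metric
open _root_.Topology
open Literature.Topology.FourManifolds Literature.Topology.FourManifolds.Foliation

namespace Literature.Topology.PlanarFoliations

namespace ProngStar

variable {X : Type*} [TopologicalSpace X] [Nonempty X] {F : Foliation ℝ X} {ι : X → ℂ} {v : ℂ} {n : ℕ}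
  (P : ProngStar F ι v n) (hι : IsOpenEmbedding ι)

/-- **The horizontals are jointly continuous** in the parameter and the height, off the puncture.
[folklore] -/
theorem continuousOn_horiz₂ (j : ZMod n) :
    ContinuousOn (fun p : ℝ × ℝ ↦ P.horiz hι j p.2 p.1) {p | p ∈ P.rect ∧ p ≠ 0} := by
  have hc : ContinuousOn (fun p : ℝ × ℝ ↦ P.pt j p) {p | p ∈ P.rect ∧ p ≠ 0} := (P.continuousOn_pt j).mono fun p hp ↦ hp.1
  refine (continuousOn_lift hι).comp hc fun p hp ↦ P.diff_subset_range j ⟨P.pt_mem hp.1, P.pt_ne hp.1 hp.2⟩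

variable {P hι}

omit [Nonempty X] in
/-- Points of a parameter box around a prong parameter are admissible parameters. [folklore] -/
theorem mem_rect_of_mem_box {b₀ δ β h : ℝ} (hδb : δ < b₀) (hbδ : b₀ + δ ≤ P.ρ) (hδρ : δ ≤ P.ρ) (hβ : β ∈ Icc (b₀ - δ) (b₀ + δ))
    (hh : h ∈ Ioo (-δ) δ) : ((β, h) : ℝ × ℝ) ∈ P.rect ∧ ((β, h) : ℝ × ℝ) ≠ 0 := by
  refine ⟨(P.mem_rect_iff).2 ⟨⟨by linarith [hβ.1], by linarith [hβ.2]⟩, ⟨by linarith [hh.1], by linarith [hh.2]⟩⟩, fun h0 ↦ ?_⟩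
  have := congrArg Prod.fst h0
  simp only [Prod.fst_zero] at this
  linarith [hβ.1]

variable (P hι)

/-- **A flow box reading the horizontals near a prong point with one monotonicity type.** Around
`x₀ = horiz j 0 b₀`, `0 < b₀ < ρ`: a box `e` of the atlas at `x₀` and `δ > 0` such that all the
horizontals `β ↦ horiz j h β`, `|h| < δ`, `|β - b₀| ≤ δ`, run in `e.source`, each in one plaque
of `e`, with leaf coordinate strictly monotone in `β` — all increasing or all decreasing.
[folklore] -/
theorem exists_box_uniform_type (j : ZMod n) {b₀ : ℝ} (hb₀ : 0 < b₀) (hb₀ρ : b₀ < P.ρ) :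
    ∃ e ∈ F.atlas, ∃ δ > (0 : ℝ), δ < b₀ ∧ b₀ + δ ≤ P.ρ ∧ P.horiz hι j 0 b₀ ∈ e.source ∧
      (∀ h ∈ Ioo (-δ) δ, ∀ β ∈ Icc (b₀ - δ) (b₀ + δ), P.horiz hι j h β ∈ e.source) ∧
      (∀ h ∈ Ioo (-δ) δ, ∀ β ∈ Icc (b₀ - δ) (b₀ + δ), ∀ β' ∈ Icc (b₀ - δ) (b₀ + δ),
        (e (P.horiz hι j h β)).2 = (e (P.horiz hι j h β')).2) ∧
      ((∀ h ∈ Ioo (-δ) δ, StrictMonoOn (fun β ↦ (e (P.horiz hι j h β)).1) (Icc (b₀ - δ) (b₀ + δ))) ∨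
        (∀ h ∈ Ioo (-δ) δ, StrictAntiOn (fun β ↦ (e (P.horiz hι j h β)).1) (Icc (b₀ - δ) (b₀ + δ)))) := by
  set x₀ := P.horiz hι j 0 b₀ with hx₀
  have hr₀ : ((b₀, (0 : ℝ)) : ℝ × ℝ) ∈ P.rect := (P.mem_rect_iff).2 ⟨⟨hb₀.le, hb₀ρ.le⟩, by simp [P.ρ_pos.le]⟩
  have hne₀ : ((b₀, (0 : ℝ)) : ℝ × ℝ) ≠ 0 := fun h ↦ by have := congrArg Prod.fst h; simp at this; linarith
  have hx₀S : ι x₀ ∈ P.S j := P.ι_horiz_mem hι hr₀ hne₀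
  -- the foliated box at `x₀`
  obtain ⟨e, he, hx₀e, U, hU, hcorr⟩ := P.foliated j x₀ hx₀S
  -- a parameter box mapped into `U ∩ e.source`
  have hcont := P.continuousOn_horiz₂ hι j
  have hnhds : U ∩ e.source ∈ 𝓝 x₀ := inter_mem hU (e.open_source.mem_nhds hx₀e)
  have hat : ContinuousWithinAt (fun p : ℝ × ℝ ↦ P.horiz hι j p.2 p.1) {p | p ∈ P.rect ∧ p ≠ 0} (b₀, 0) := hcont _ ⟨hr₀, hne₀⟩
  have hpre := hat.preimage_mem_nhdsWithin hnhds
  obtain ⟨ε, hε, hεsub⟩ := Metric.mem_nhdsWithin_iff.1 hpre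
  -- choose `δ`
  set δ := min (ε / 2) (min (b₀ / 2) ((P.ρ - b₀) / 2)) with hδ
  have hδpos : 0 < δ := lt_min (by linarith) (lt_min (by linarith) (by linarith))
  have hδε : δ ≤ ε / 2 := min_le_left _ _
  have hδb : δ < b₀ := by have := (min_le_right _ _ : δ ≤ _).trans (min_le_left _ _); linarith
  have hbδ : b₀ + δ ≤ P.ρ := by have := (min_le_right _ _ : δ ≤ _).trans (min_le_right _ _); linarith
  have hδρ : δ ≤ P.ρ := by linarith [hb₀.le]
  have hbox : ∀ h ∈ Ioo (-δ) δ, ∀ β ∈ Icc (b₀ - δ) (b₀ + δ), P.horiz hι j h β ∈ U ∩ e.source := by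
    intro h hh β hβ
    obtain ⟨hr, hne⟩ := mem_rect_of_mem_box hδb hbδ hδρ hβ hh
    have hdist : dist ((β, h) : ℝ × ℝ) (b₀, 0) < ε := by
      rw [Prod.dist_eq, Real.dist_eq, Real.dist_eq, sub_zero, max_lt_iff]
      constructor
      · rw [abs_lt]; constructor <;> linarith [hβ.1, hβ.2]
      · rw [abs_lt]; constructor <;> linarith [hh.1, hh.2]
    exact hεsub ⟨hdist, hr, hne⟩
  -- horizontals lie in plaques of `e`
  have hplaque : ∀ h ∈ Ioo (-δ) δ, ∀ β ∈ Icc (b₀ - δ) (b₀ + δ), ∀ β' ∈ Icc (b₀ - δ) (b₀ + δ),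
      (e (P.horiz hι j h β)).2 = (e (P.horiz hι j h β')).2 := by
    intro h hh β hβ β' hβ'
    obtain ⟨hr, hne⟩ := mem_rect_of_mem_box hδb hbδ hδρ hβ hh
    obtain ⟨hr', hne'⟩ := mem_rect_of_mem_box hδb hbδ hδρ hβ' hh
    have hS : ι (P.horiz hι j h β) ∈ P.S j := P.ι_horiz_mem hι hr hne
    have hS' : ι (P.horiz hι j h β') ∈ P.S j := P.ι_horiz_mem hι hr' hne'
    have hH : P.H (ι (P.horiz hι j h β)) = P.H (ι (P.horiz hι j h β')) := by rw [P.H_horiz hι hr hne, P.H_horiz hι hr' hne']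
    have h1 := hcorr _ (hbox h hh β hβ).1 hS _ (hbox h hh β' hβ').1 hS'
    have h2 := hcorr _ (hbox h hh β' hβ').1 hS' _ (hbox h hh β hβ).1 hS
    rcases lt_trichotomy (e (P.horiz hι j h β)).2 (e (P.horiz hι j h β')).2 with hlt | heq | hgt
    · exact absurd (h1.1 hlt) (by rw [hH]; exact lt_irrefl _)
    · exact heq
    · exact absurd (h2.1 hgt) (by rw [hH]; exact lt_irrefl _)
  refine ⟨e, he, δ, hδpos, hδb, hbδ, hx₀e, fun h hh β hβ ↦ (hbox h hh β hβ).2, hplaque, ?_⟩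
  -- one monotonicity type, by the one-type lemma for continuous injective families
  have hf : ContinuousOn (fun p : ℝ × ℝ ↦ (e (P.horiz hι j p.2 p.1)).1) (Icc (b₀ - δ) (b₀ + δ) ×ˢ Ioo (-δ) δ) := by
    refine (continuous_fst.comp_continuousOn (e.continuousOn.comp (hcont.mono fun p hp ↦ ?_) fun p hp ↦ (hbox p.2 hp.2 p.1 hp.1).2))
    exact mem_rect_of_mem_box hδb hbδ hδρ hp.1 hp.2
  have hinj : ∀ h ∈ Ioo (-δ) δ, InjOn (fun β ↦ (e (P.horiz hι j h β)).1) (Icc (b₀ - δ) (b₀ + δ)) := by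
    intro h hh β hβ β' hβ' hββ'
    have heq : e (P.horiz hι j h β) = e (P.horiz hι j h β') := Prod.ext hββ' (hplaque h hh β hβ β' hβ')
    have hpt : P.horiz hι j h β = P.horiz hι j h β' := e.injOn (hbox h hh β hβ).2 (hbox h hh β' hβ').2 heq
    obtain ⟨hr, hne⟩ := mem_rect_of_mem_box hδb hbδ hδρ hβ hh
    obtain ⟨hr', hne'⟩ := mem_rect_of_mem_box hδb hbδ hδρ hβ' hh
    have := congrArg ι hpt
    rw [P.ι_horiz hι hr hne, P.ι_horiz hι hr' hne'] at this
    -- `pt` is injective on the half square: read both sides in the sector chart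
    have hpq : ((β, h) : ℝ × ℝ) = (β', h) := by rw [← P.chart_pt hr (j := j), ← P.chart_pt hr' (j := j), this]
    exact congrArg Prod.fst hpq
  exact strictMonoOn_forall_or_strictAntiOn_forall (f := fun p : ℝ × ℝ ↦ (e (P.horiz hι j p.2 p.1)).1) (by linarith)
    isPreconnected_Ioo hf hinj

end ProngStar

end Literature.Topology.PlanarFoliations
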